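import Summits.BirchSwinnertonDyer.BirchSwinnertonDyer.Theorems.QuadraticBranchSignedControlNoFiniteSubmoduleOfStrictLayersTransition
import Summits.BirchSwinnertonDyer.Rank1Residual.Iwasawa.DivisiblePartsStationary
import HarnessLib

/-!
# The K8 node (R2±) `NoFiniteSubmoduleSigned` from Cassels–Tate-type pairings on the layers WITH THE
# STABILISATION OF THE DIVISIBLE PARTS DISCHARGED: Kitajima–Otsuki Prop. 4.4 / Hachimori–Matsuno's
# "bounded corank" step is now a kernel theorem (cell `bsd-potss`, seat `bsd-potss-k8q-c5` g4; route
# `QuadraticBranchSignedControl`, items stmt-BirchSwinnertonDyer-19117 / 19222 / 19233, binder 19301)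

HONEST FRAMING (cell `bsd-potss`, run/shared/lean/pub/bsd-potss/; FULL-BSD rank ≤ 1 programme,
tranche 1b): THEOREMS ONLY, all CONDITIONAL — nothing here closes an item; the three (R2±) items stay
settled by citation through `PublishedInputKO13` (Kitajima–Otsuki 2018 Main Thm. 1.3, `F = ℚ`); BSD
is not proved by any of this; no label / mark / count moves.

Sequel of g3's p454831 (`noFiniteSubmoduleSigned_of_casselsTateLayerInputs`), whose displayed package
per sign was: corestriction + adjointness · subgroups `D_n` (`p`-divisible, `conj_γ`-stable) WITH A
STABILISATION INDEX `m` (`r_{n+1}(D_{n+1}) ⊆ r_n(D_n)` for `n ≥ m`) · the `conj_γ`-invariant pairing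
with right kernel `D_n` representing the characters of `Sel^{ε,str}(W/ℚ_n)/D_n`. HERE the index `m`
and the stabilisation clause are GONE (so is the `conj_γ`-stability of `D_n`, a consequence of the
invariance of the pairing): they are PROVED from the node's own hypotheses "`X` finitely generated
and `Λ`-torsion" by the pure-algebra theorem
`Rank1Residual.Iwasawa.forall_finite_eq_bot_of_selfDualLayers_of_isTorsion` (annihilators of divisible
`Γ`-stable subgroups are `p`-saturated `Λ`-submodules; `ℤ_p`-co-ranks bounded by that of `X/gX`,
`p ∤ g`; rank–nullity; character separation), at the price of the STRUCTURAL clause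
`ι_n(D_n) ⊆ D_{n+1}` (restriction maps divisible elements to divisible elements — automatic for the
maximal divisible subgroups of print). What stays displayed is therefore exactly: the corestriction
`Sel^{ε,str}(W/ℚ_{n+1}) → Sel^{ε,str}(W/ℚ_n)` with `res ∘ cores = Σ_{i<p} conj_γ^{pⁿ i}`, adjoint to
restriction under the pairings, and the generalised Cassels–Tate pairing itself (Flach 1990; B. D. Kim
2007 Prop. 3.18 for the self-duality of the `±` condition, read at `η`) — `p`-divisible
restriction-compatible right kernels, every character of the quotient represented, `conj_γ`-invariance.

References: [HachimoriMatsuno2000] Theorem and its proof (p. 2540); [KitajimaOtsuki2018] Prop. 4.1,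
Lemma 4.2, Prop. 4.4, Thm. 4.5, Main Thm. 1.3 (arXiv:1607.03612 pp. 3, 18); [Kobayashi2003] Def. 2.1,
Thm. 2.2 (p. 5), Lemma 9.1 (p. 25); [GreenbergLNM1716] proof of Prop. 4.14 (p. 104).
-/

set_option autoImplicit false
-- `Summit.BirchSwinnertonDyer.BirchSwinnertonDyer.…` is the lane's mandated namespace (sub = summit).
set_option linter.dupNamespace false

noncomputable section

open scoped Classical

universe u

open WeierstrassCurve Field Literature.NumberTheory.EllipticCurves
  Literature.NumberTheory.EllipticCurves.Kobayashi2003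
  Literature.NumberTheory.GaloisRepresentations ZpExtension
  Summit.BirchSwinnertonDyer.Rank1Residual Summit.BirchSwinnertonDyer.Rank1Residual.Additive

namespace Summit.BirchSwinnertonDyer.BirchSwinnertonDyer.Theorems

open Summit.BirchSwinnertonDyer.BirchSwinnertonDyer.Theses.QuadraticBranchSignedControl

/-! ## §1 Any strict signed dual datum: the layer package WITHOUT stabilisation index -/

section StrictLayers

variable {K : Type u} [Field K] [NumberField K] {W : WeierstrassCurve K} {p : ℕ} [Fact p.Prime]
  {κ : ZpExtension K p} {E : Type u} [Field E] [Algebra K E] {γ : Field.absoluteGaloisGroup K} {ε : ℤˣ}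

/-- **`X^{ε,str}(W/K_∞)` has no non-zero finite `Λ`-submodule, given the Hachimori–Matsuno package ON
THE TREE'S LAYERS without stabilisation index** — any number field `K`, `ℤ_p`-extension `κ` with
topological generator `γ`, model `E`, sign `ε`, datum `D` with `X` finitely generated and `Λ`-TORSION.
Displayed: injective pinned restrictions `r_n`, pinned `γL_n`, transitions `ι_n` over `Sel_∞`,
corestrictions realising `Σ_{i<p} conj_γ^{pⁿ i}` adjoint to `ι_n`, subgroups `D_n` (`p`-divisible,
`ι_n(D_n) ⊆ D_{n+1}`), `γL_n`-invariant pairings with right kernel exactly `D_n` representing every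
character of `Sel^{ε,str}(K_n)/D_n`. The stabilisation of `r_n(D_n)` is PROVED
(`Iwasawa.exists_forall_map_le_map_of_isTorsion`), the `conj_γ`-stability of the right kernels follows
from the invariance of the pairing; exhaustion and `Γ`-action are g3's kernel theorems.
CONDITIONAL; nothing about these inputs is asserted.
[cite: HachimoriMatsuno2000, Theorem and Corollary (i) (p. 2540)]
[cite: KitajimaOtsuki2018, Prop. 4.1, Lemma 4.2, Prop. 4.4, Thm. 4.5 (arXiv:1607.03612 p. 18)] -/
theorem StrictSignedSelmerDualData.forall_finite_eq_bot_of_strictLayerPackage_of_isTorsion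
    (hγ : κ.IsTopGenerator γ) (D : StrictSignedSelmerDualData W κ E γ ε)
    [Module.Finite (IwasawaAlgebra p) D.X] (htor : Module.IsTorsion (IwasawaAlgebra p) D.X)
    (hpack : ∃ (r : ∀ n, strictSignedSelmerLayer W κ E ε n →+ strictSignedSelmerInfty W κ E ε)
        (γL : ∀ n, strictSignedSelmerLayer W κ E ε n →+ strictSignedSelmerLayer W κ E ε n)
        (ι : ∀ n, strictSignedSelmerLayer W κ E ε n →+ strictSignedSelmerLayer W κ E ε (n + 1))
        (Dn : ∀ n, AddSubgroup (strictSignedSelmerLayer W κ E ε n))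
        (pair : ∀ n, strictSignedSelmerLayer W κ E ε n →+ strictSignedSelmerLayer W κ E ε n →+
          AddCircle (1 : ℚ)),
      (∀ n (x : strictSignedSelmerLayer W κ E ε n),
        ((r n x : strictSignedSelmerInfty W κ E ε) : W.subgroupH1 p κ.kerSubgroup) =
          W.layerToInfty κ n (x : W.subgroupH1 p (κ.layerSubgroup n))) ∧
      (∀ n (x : strictSignedSelmerLayer W κ E ε n),
        ((γL n x : strictSignedSelmerLayer W κ E ε n) : W.subgroupH1 p (κ.layerSubgroup n)) =
          W.conjH1 p (κ.layerSubgroup n) γ (x : W.subgroupH1 p (κ.layerSubgroup n))) ∧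
      (∀ n, Function.Injective (r n)) ∧
      (∀ n (x : strictSignedSelmerLayer W κ E ε n), r (n + 1) (ι n x) = r n x) ∧
      (∀ n (t : strictSignedSelmerLayer W κ E ε (n + 1)), ∃ t' : strictSignedSelmerLayer W κ E ε n,
        r n t' = ∑ i ∈ Finset.range p,
          ((conjStrictSignedSelmerInfty W κ E ε γ) ^ (p ^ n * i)) (r (n + 1) t) ∧
        ∀ y : strictSignedSelmerLayer W κ E ε n, pair n y t' = pair (n + 1) (ι n y) t) ∧
      (∀ n, ∀ d ∈ Dn n, ∃ d' ∈ Dn n, p • d' = d) ∧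
      (∀ n, ∀ d ∈ Dn n, ι n d ∈ Dn (n + 1)) ∧
      (∀ n (t : strictSignedSelmerLayer W κ E ε n),
        (∀ y : strictSignedSelmerLayer W κ E ε n, pair n y t = 0) → t ∈ Dn n) ∧
      (∀ n, ∀ t ∈ Dn n, ∀ y : strictSignedSelmerLayer W κ E ε n, pair n y t = 0) ∧
      (∀ n (g : strictSignedSelmerLayer W κ E ε n →+ AddCircle (1 : ℚ)), (∀ d ∈ Dn n, g d = 0) →
        ∃ c : strictSignedSelmerLayer W κ E ε n, ∀ y : strictSignedSelmerLayer W κ E ε n,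
          g y = pair n y c) ∧
      (∀ n (y t : strictSignedSelmerLayer W κ E ε n), pair n (γL n y) (γL n t) = pair n y t)) :
    ∀ M : Submodule (IwasawaAlgebra p) D.X, Finite M → M = ⊥ := by
  obtain ⟨r, γL, ι, Dn, pair, hr, hγL, hinj, hι, hcores, hDdiv, hDι, hker, hD0, hsurj, hinv⟩ :=
    hpack
  -- the right kernels are `conj_γ`-stable: `⟨y, γ t⟩ = ⟨γ y', γ t⟩ = ⟨y', t⟩ = 0` (`γL_n` onto)
  have hDγ : ∀ n, ∀ d ∈ Dn n, γL n d ∈ Dn n := fun n d hd ↦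
    hker n (γL n d) fun y ↦ by
      obtain ⟨y', rfl⟩ := strictLayer_conj_surjective γL hγL n y
      rw [hinv]
      exact hD0 n d hd y'
  exact Iwasawa.forall_finite_eq_bot_of_selfDualLayers_of_isTorsion p
    (conjStrictSignedSelmerInfty W κ E ε γ) r ι γL Dn pair D.toDual
    (StrictSignedControlZero.isDualPair D hγ) htor hinj hι (strictLayer_exhaustion r hr ι hι)
    (strictLayer_r_conj r hr γL hγL) (strictLayer_conj_surjective γL hγL) hcores hDdiv hDγ hDι hker
    hD0 hsurj hinv

end StrictLayers

/-! ## §2 The K8 nodes from Cassels–Tate-type pairings on `Sel^{±,str}(W/ℚ_n)` — no stabilisation input -/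

/-- **(R2⁺) `NoFiniteSubmodulePlus` (item stmt-BirchSwinnertonDyer-19222) from Cassels–Tate-type
pairings on the tree's layers `Sel^{+,str}(W/ℚ_n)`**: for the pinned restrictions `r_n`, conjugation
`γL_n` and transitions `ι_n` (they exist, p454831 §2), the consumer supplies ONLY corestrictions
realising the norm and adjoint to `ι_n`, subgroups `D_n` (`p`-divisible, `ι_n(D_n) ⊆ D_{n+1}`) and
`conj_γ`-invariant pairings with right kernel exactly `D_n` representing every character of
`Sel^{+,str}(W/ℚ_n)/D_n`. Injectivity (Kobayashi 9.1, p453559), exhaustion and `Γ`-action (p452849),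
transitions (p454831) and NOW the stabilisation of the `r_n(D_n)` (from the node's `Λ`-torsion
hypothesis, `Iwasawa.exists_forall_map_le_map_of_isTorsion`) and the `conj_γ`-stability of `D_n`
(from the invariance of the pairing) are kernel theorems.
CONDITIONAL; closes nothing by itself. [cite: HachimoriMatsuno2000, Theorem and Corollary (i) (p. 2540)]
[cite: KitajimaOtsuki2018, Prop. 4.4, Thm. 4.5 (arXiv:1607.03612 p. 18)]
[cite: Kobayashi2003, Def. 2.1, Thm. 2.2 (p. 5), Lemma 9.1 (p. 25)] -/
theorem noFiniteSubmodulePlus_of_casselsTatePairings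
    (h : ∀ (W : WeierstrassCurve ℚ) [W.IsElliptic] [W.IsGloballyMinimal] (p : ℕ) [Fact p.Prime]
        (V : WeierstrassCurve ℚ) [V.IsElliptic] [V.IsGloballyMinimal] (C : VariableChange ℚ),
      5 ≤ p → C • W.quadraticTwist ((-1) ^ (p / 2) * p) = V →
      V.HasGoodReductionAtPrime p → V.frobeniusTrace p = 0 →
      ∀ (κ : ZpExtension ℚ p) (γ : Field.absoluteGaloisGroup ℚ),
        κ.IsCyclotomic → κ.IsTopGenerator γ →
      ∀ (D : StrictSignedSelmerDualData W κ ℚ_[p] γ 1),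
        Module.Finite (IwasawaAlgebra p) D.X → Module.IsTorsion (IwasawaAlgebra p) D.X →
      ∀ (r : ∀ n, strictSignedSelmerLayer W κ ℚ_[p] 1 n →+ strictSignedSelmerInfty W κ ℚ_[p] 1),
        (∀ n (x : strictSignedSelmerLayer W κ ℚ_[p] 1 n),
          ((r n x : strictSignedSelmerInfty W κ ℚ_[p] 1) : W.subgroupH1 p κ.kerSubgroup) =
            W.layerToInfty κ n (x : W.subgroupH1 p (κ.layerSubgroup n))) →
      ∀ (γL : ∀ n, strictSignedSelmerLayer W κ ℚ_[p] 1 n →+ strictSignedSelmerLayer W κ ℚ_[p] 1 n),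
        (∀ n (x : strictSignedSelmerLayer W κ ℚ_[p] 1 n),
          ((γL n x : strictSignedSelmerLayer W κ ℚ_[p] 1 n) : W.subgroupH1 p (κ.layerSubgroup n)) =
            W.conjH1 p (κ.layerSubgroup n) γ (x : W.subgroupH1 p (κ.layerSubgroup n))) →
      ∀ (ι : ∀ n, strictSignedSelmerLayer W κ ℚ_[p] 1 n →+ strictSignedSelmerLayer W κ ℚ_[p] 1 (n + 1)),
        (∀ n (x : strictSignedSelmerLayer W κ ℚ_[p] 1 n),
          ((ι n x : strictSignedSelmerLayer W κ ℚ_[p] 1 (n + 1)) : W.subgroupH1 p (κ.layerSubgroup (n + 1))) =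
            W.resOfLe p (κ.layerSubgroup_antitone n.le_succ)
              (x : W.subgroupH1 p (κ.layerSubgroup n))) →
      ∃ (Dn : ∀ n, AddSubgroup (strictSignedSelmerLayer W κ ℚ_[p] 1 n))
        (pair : ∀ n, strictSignedSelmerLayer W κ ℚ_[p] 1 n →+ strictSignedSelmerLayer W κ ℚ_[p] 1 n →+ AddCircle (1 : ℚ)),
      (∀ n (t : strictSignedSelmerLayer W κ ℚ_[p] 1 (n + 1)), ∃ t' : strictSignedSelmerLayer W κ ℚ_[p] 1 n,
        r n t' = ∑ i ∈ Finset.range p,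
          ((conjStrictSignedSelmerInfty W κ ℚ_[p] 1 γ) ^ (p ^ n * i)) (r (n + 1) t) ∧
        ∀ y : strictSignedSelmerLayer W κ ℚ_[p] 1 n, pair n y t' = pair (n + 1) (ι n y) t) ∧
      (∀ n, ∀ d ∈ Dn n, ∃ d' ∈ Dn n, p • d' = d) ∧
      (∀ n, ∀ d ∈ Dn n, ι n d ∈ Dn (n + 1)) ∧
      (∀ n (t : strictSignedSelmerLayer W κ ℚ_[p] 1 n),
        (∀ y : strictSignedSelmerLayer W κ ℚ_[p] 1 n, pair n y t = 0) → t ∈ Dn n) ∧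
      (∀ n, ∀ t ∈ Dn n, ∀ y : strictSignedSelmerLayer W κ ℚ_[p] 1 n, pair n y t = 0) ∧
      (∀ n (g : strictSignedSelmerLayer W κ ℚ_[p] 1 n →+ AddCircle (1 : ℚ)), (∀ d ∈ Dn n, g d = 0) →
        ∃ c : strictSignedSelmerLayer W κ ℚ_[p] 1 n, ∀ y : strictSignedSelmerLayer W κ ℚ_[p] 1 n, g y = pair n y c) ∧
      (∀ n (y t : strictSignedSelmerLayer W κ ℚ_[p] 1 n), pair n (γL n y) (γL n t) = pair n y t)) :
    NoFiniteSubmodulePlus := by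
  intro W _ _ p _ hp5 V _ _ C hp2 hC hgood hap κ γ hκ hγ D hfin htor M hM
  obtain ⟨r, hr⟩ := exists_strictLayer_r W κ ℚ_[p] (1 : ℤˣ)
  obtain ⟨γL, hγL⟩ := exists_strictLayer_γL W κ ℚ_[p] (1 : ℤˣ) γ
  obtain ⟨ι, hι⟩ := exists_strictLayer_ι W κ ℚ_[p] (1 : ℤˣ)
  obtain ⟨Dn, pair, hcores, hDdiv, hDι, hker, hD0, hsurj, hinv⟩ :=
    h W p V C hp5 hC hgood hap κ γ hκ hγ D hfin htor r hr γL hγL ι hι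
  haveI := hfin
  exact StrictSignedSelmerDualData.forall_finite_eq_bot_of_strictLayerPackage_of_isTorsion hγ D htor
    ⟨r, γL, ι, Dn, pair, hr, hγL,
      strictLayer_r_injective_of_fixedPoints_eq_bot hγ (fixedPoints_eq_bot_of_gss2 κ hp2 W C hC hgood hap)
        r hr,
      strictLayer_r_transition r hr ι hι, hcores, hDdiv, hDι, hker, hD0, hsurj, hinv⟩ M hM

/-- **(R2⁻) `NoFiniteSubmoduleMinus` (item stmt-BirchSwinnertonDyer-19233), same reduction** (strict
minus condition; no stabilisation input). CONDITIONAL; closes nothing by itself.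
[cite: HachimoriMatsuno2000, Theorem and Corollary (i) (p. 2540)]
[cite: KitajimaOtsuki2018, Prop. 4.4, Thm. 4.5 (arXiv:1607.03612 p. 18)]
[cite: Kobayashi2003, Def. 2.1, §2 p. 4 (m = −1), Thm. 2.2 (p. 5), Lemma 9.1 (p. 25)] -/
theorem noFiniteSubmoduleMinus_of_casselsTatePairings
    (h : ∀ (W : WeierstrassCurve ℚ) [W.IsElliptic] [W.IsGloballyMinimal] (p : ℕ) [Fact p.Prime]
        (V : WeierstrassCurve ℚ) [V.IsElliptic] [V.IsGloballyMinimal] (C : VariableChange ℚ),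
      5 ≤ p → C • W.quadraticTwist ((-1) ^ (p / 2) * p) = V →
      V.HasGoodReductionAtPrime p → V.frobeniusTrace p = 0 →
      ∀ (κ : ZpExtension ℚ p) (γ : Field.absoluteGaloisGroup ℚ),
        κ.IsCyclotomic → κ.IsTopGenerator γ →
      ∀ (D : StrictSignedSelmerDualData W κ ℚ_[p] γ (-1)),
        Module.Finite (IwasawaAlgebra p) D.X → Module.IsTorsion (IwasawaAlgebra p) D.X →
      ∀ (r : ∀ n, strictSignedSelmerLayer W κ ℚ_[p] (-1) n →+ strictSignedSelmerInfty W κ ℚ_[p] (-1)),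
        (∀ n (x : strictSignedSelmerLayer W κ ℚ_[p] (-1) n),
          ((r n x : strictSignedSelmerInfty W κ ℚ_[p] (-1)) : W.subgroupH1 p κ.kerSubgroup) =
            W.layerToInfty κ n (x : W.subgroupH1 p (κ.layerSubgroup n))) →
      ∀ (γL : ∀ n, strictSignedSelmerLayer W κ ℚ_[p] (-1) n →+ strictSignedSelmerLayer W κ ℚ_[p] (-1) n),
        (∀ n (x : strictSignedSelmerLayer W κ ℚ_[p] (-1) n),
          ((γL n x : strictSignedSelmerLayer W κ ℚ_[p] (-1) n) : W.subgroupH1 p (κ.layerSubgroup n)) =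
            W.conjH1 p (κ.layerSubgroup n) γ (x : W.subgroupH1 p (κ.layerSubgroup n))) →
      ∀ (ι : ∀ n, strictSignedSelmerLayer W κ ℚ_[p] (-1) n →+ strictSignedSelmerLayer W κ ℚ_[p] (-1) (n + 1)),
        (∀ n (x : strictSignedSelmerLayer W κ ℚ_[p] (-1) n),
          ((ι n x : strictSignedSelmerLayer W κ ℚ_[p] (-1) (n + 1)) : W.subgroupH1 p (κ.layerSubgroup (n + 1))) =
            W.resOfLe p (κ.layerSubgroup_antitone n.le_succ)
              (x : W.subgroupH1 p (κ.layerSubgroup n))) →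
      ∃ (Dn : ∀ n, AddSubgroup (strictSignedSelmerLayer W κ ℚ_[p] (-1) n))
        (pair : ∀ n, strictSignedSelmerLayer W κ ℚ_[p] (-1) n →+ strictSignedSelmerLayer W κ ℚ_[p] (-1) n →+ AddCircle (1 : ℚ)),
      (∀ n (t : strictSignedSelmerLayer W κ ℚ_[p] (-1) (n + 1)), ∃ t' : strictSignedSelmerLayer W κ ℚ_[p] (-1) n,
        r n t' = ∑ i ∈ Finset.range p,
          ((conjStrictSignedSelmerInfty W κ ℚ_[p] (-1) γ) ^ (p ^ n * i)) (r (n + 1) t) ∧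
        ∀ y : strictSignedSelmerLayer W κ ℚ_[p] (-1) n, pair n y t' = pair (n + 1) (ι n y) t) ∧
      (∀ n, ∀ d ∈ Dn n, ∃ d' ∈ Dn n, p • d' = d) ∧
      (∀ n, ∀ d ∈ Dn n, ι n d ∈ Dn (n + 1)) ∧
      (∀ n (t : strictSignedSelmerLayer W κ ℚ_[p] (-1) n),
        (∀ y : strictSignedSelmerLayer W κ ℚ_[p] (-1) n, pair n y t = 0) → t ∈ Dn n) ∧
      (∀ n, ∀ t ∈ Dn n, ∀ y : strictSignedSelmerLayer W κ ℚ_[p] (-1) n, pair n y t = 0) ∧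
      (∀ n (g : strictSignedSelmerLayer W κ ℚ_[p] (-1) n →+ AddCircle (1 : ℚ)), (∀ d ∈ Dn n, g d = 0) →
        ∃ c : strictSignedSelmerLayer W κ ℚ_[p] (-1) n, ∀ y : strictSignedSelmerLayer W κ ℚ_[p] (-1) n, g y = pair n y c) ∧
      (∀ n (y t : strictSignedSelmerLayer W κ ℚ_[p] (-1) n), pair n (γL n y) (γL n t) = pair n y t)) :
    NoFiniteSubmoduleMinus := by
  intro W _ _ p _ hp5 V _ _ C hp2 hC hgood hap κ γ hκ hγ D hfin htor M hM
  obtain ⟨r, hr⟩ := exists_strictLayer_r W κ ℚ_[p] ((-1) : ℤˣ)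
  obtain ⟨γL, hγL⟩ := exists_strictLayer_γL W κ ℚ_[p] ((-1) : ℤˣ) γ
  obtain ⟨ι, hι⟩ := exists_strictLayer_ι W κ ℚ_[p] ((-1) : ℤˣ)
  obtain ⟨Dn, pair, hcores, hDdiv, hDι, hker, hD0, hsurj, hinv⟩ :=
    h W p V C hp5 hC hgood hap κ γ hκ hγ D hfin htor r hr γL hγL ι hι
  haveI := hfin
  exact StrictSignedSelmerDualData.forall_finite_eq_bot_of_strictLayerPackage_of_isTorsion hγ D htor
    ⟨r, γL, ι, Dn, pair, hr, hγL,
      strictLayer_r_injective_of_fixedPoints_eq_bot hγ (fixedPoints_eq_bot_of_gss2 κ hp2 W C hC hgood hap)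
        r hr,
      strictLayer_r_transition r hr ι hι, hcores, hDdiv, hDι, hker, hD0, hsurj, hinv⟩ M hM

/-- **(R2±) the K8 node `NoFiniteSubmoduleSigned` (item stmt-BirchSwinnertonDyer-19117) from
Cassels–Tate-type pairings on the layers of both signs, WITHOUT stabilisation input** — after g0 (η
reading), g2 (Kitajima–Otsuki §4.2), g3 (§4.1: Hachimori–Matsuno mechanism, Kobayashi 9.1, exhaustion,
`Γ`-action, transitions) and this file (Prop. 4.4: stabilisation from `Λ`-torsion), what is displayed
per sign and Gss2 datum is exactly: corestriction with `res ∘ cores = Σ_{i<p} conj_γ^{pⁿ i}` adjoint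
to restriction, and the `conj_γ`-invariant non-degenerate pairing on `Sel^{ε,str}(W/ℚ_n)` modulo a
`p`-divisible restriction-compatible right kernel (in print: Flach 1990 / B. D. Kim
2007 Prop. 3.18 read at `η` — the generalised Cassels–Tate pairing, kernel = maximal divisible
subgroup). CONDITIONAL; closes nothing by itself.
[cite: HachimoriMatsuno2000, Theorem and Corollary (i) (p. 2540)]
[cite: KitajimaOtsuki2018, Main Thm. 1.3, Prop. 4.1, Lemma 4.2, Prop. 4.4, Thm. 4.5 (arXiv:1607.03612 pp. 3, 18)] -/
theorem noFiniteSubmoduleSigned_of_casselsTatePairings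
    (hplus : ∀ (W : WeierstrassCurve ℚ) [W.IsElliptic] [W.IsGloballyMinimal] (p : ℕ) [Fact p.Prime]
        (V : WeierstrassCurve ℚ) [V.IsElliptic] [V.IsGloballyMinimal] (C : VariableChange ℚ),
      5 ≤ p → C • W.quadraticTwist ((-1) ^ (p / 2) * p) = V →
      V.HasGoodReductionAtPrime p → V.frobeniusTrace p = 0 →
      ∀ (κ : ZpExtension ℚ p) (γ : Field.absoluteGaloisGroup ℚ),
        κ.IsCyclotomic → κ.IsTopGenerator γ →
      ∀ (D : StrictSignedSelmerDualData W κ ℚ_[p] γ 1),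
        Module.Finite (IwasawaAlgebra p) D.X → Module.IsTorsion (IwasawaAlgebra p) D.X →
      ∀ (r : ∀ n, strictSignedSelmerLayer W κ ℚ_[p] 1 n →+ strictSignedSelmerInfty W κ ℚ_[p] 1),
        (∀ n (x : strictSignedSelmerLayer W κ ℚ_[p] 1 n),
          ((r n x : strictSignedSelmerInfty W κ ℚ_[p] 1) : W.subgroupH1 p κ.kerSubgroup) =
            W.layerToInfty κ n (x : W.subgroupH1 p (κ.layerSubgroup n))) →
      ∀ (γL : ∀ n, strictSignedSelmerLayer W κ ℚ_[p] 1 n →+ strictSignedSelmerLayer W κ ℚ_[p] 1 n),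
        (∀ n (x : strictSignedSelmerLayer W κ ℚ_[p] 1 n),
          ((γL n x : strictSignedSelmerLayer W κ ℚ_[p] 1 n) : W.subgroupH1 p (κ.layerSubgroup n)) =
            W.conjH1 p (κ.layerSubgroup n) γ (x : W.subgroupH1 p (κ.layerSubgroup n))) →
      ∀ (ι : ∀ n, strictSignedSelmerLayer W κ ℚ_[p] 1 n →+ strictSignedSelmerLayer W κ ℚ_[p] 1 (n + 1)),
        (∀ n (x : strictSignedSelmerLayer W κ ℚ_[p] 1 n),
          ((ι n x : strictSignedSelmerLayer W κ ℚ_[p] 1 (n + 1)) : W.subgroupH1 p (κ.layerSubgroup (n + 1))) =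
            W.resOfLe p (κ.layerSubgroup_antitone n.le_succ)
              (x : W.subgroupH1 p (κ.layerSubgroup n))) →
      ∃ (Dn : ∀ n, AddSubgroup (strictSignedSelmerLayer W κ ℚ_[p] 1 n))
        (pair : ∀ n, strictSignedSelmerLayer W κ ℚ_[p] 1 n →+ strictSignedSelmerLayer W κ ℚ_[p] 1 n →+ AddCircle (1 : ℚ)),
      (∀ n (t : strictSignedSelmerLayer W κ ℚ_[p] 1 (n + 1)), ∃ t' : strictSignedSelmerLayer W κ ℚ_[p] 1 n,
        r n t' = ∑ i ∈ Finset.range p,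
          ((conjStrictSignedSelmerInfty W κ ℚ_[p] 1 γ) ^ (p ^ n * i)) (r (n + 1) t) ∧
        ∀ y : strictSignedSelmerLayer W κ ℚ_[p] 1 n, pair n y t' = pair (n + 1) (ι n y) t) ∧
      (∀ n, ∀ d ∈ Dn n, ∃ d' ∈ Dn n, p • d' = d) ∧
      (∀ n, ∀ d ∈ Dn n, ι n d ∈ Dn (n + 1)) ∧
      (∀ n (t : strictSignedSelmerLayer W κ ℚ_[p] 1 n),
        (∀ y : strictSignedSelmerLayer W κ ℚ_[p] 1 n, pair n y t = 0) → t ∈ Dn n) ∧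
      (∀ n, ∀ t ∈ Dn n, ∀ y : strictSignedSelmerLayer W κ ℚ_[p] 1 n, pair n y t = 0) ∧
      (∀ n (g : strictSignedSelmerLayer W κ ℚ_[p] 1 n →+ AddCircle (1 : ℚ)), (∀ d ∈ Dn n, g d = 0) →
        ∃ c : strictSignedSelmerLayer W κ ℚ_[p] 1 n, ∀ y : strictSignedSelmerLayer W κ ℚ_[p] 1 n, g y = pair n y c) ∧
      (∀ n (y t : strictSignedSelmerLayer W κ ℚ_[p] 1 n), pair n (γL n y) (γL n t) = pair n y t))
    (hminus : ∀ (W : WeierstrassCurve ℚ) [W.IsElliptic] [W.IsGloballyMinimal] (p : ℕ) [Fact p.Prime]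
        (V : WeierstrassCurve ℚ) [V.IsElliptic] [V.IsGloballyMinimal] (C : VariableChange ℚ),
      5 ≤ p → C • W.quadraticTwist ((-1) ^ (p / 2) * p) = V →
      V.HasGoodReductionAtPrime p → V.frobeniusTrace p = 0 →
      ∀ (κ : ZpExtension ℚ p) (γ : Field.absoluteGaloisGroup ℚ),
        κ.IsCyclotomic → κ.IsTopGenerator γ →
      ∀ (D : StrictSignedSelmerDualData W κ ℚ_[p] γ (-1)),
        Module.Finite (IwasawaAlgebra p) D.X → Module.IsTorsion (IwasawaAlgebra p) D.X →
      ∀ (r : ∀ n, strictSignedSelmerLayer W κ ℚ_[p] (-1) n →+ strictSignedSelmerInfty W κ ℚ_[p] (-1)),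
        (∀ n (x : strictSignedSelmerLayer W κ ℚ_[p] (-1) n),
          ((r n x : strictSignedSelmerInfty W κ ℚ_[p] (-1)) : W.subgroupH1 p κ.kerSubgroup) =
            W.layerToInfty κ n (x : W.subgroupH1 p (κ.layerSubgroup n))) →
      ∀ (γL : ∀ n, strictSignedSelmerLayer W κ ℚ_[p] (-1) n →+ strictSignedSelmerLayer W κ ℚ_[p] (-1) n),
        (∀ n (x : strictSignedSelmerLayer W κ ℚ_[p] (-1) n),
          ((γL n x : strictSignedSelmerLayer W κ ℚ_[p] (-1) n) : W.subgroupH1 p (κ.layerSubgroup n)) =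
            W.conjH1 p (κ.layerSubgroup n) γ (x : W.subgroupH1 p (κ.layerSubgroup n))) →
      ∀ (ι : ∀ n, strictSignedSelmerLayer W κ ℚ_[p] (-1) n →+ strictSignedSelmerLayer W κ ℚ_[p] (-1) (n + 1)),
        (∀ n (x : strictSignedSelmerLayer W κ ℚ_[p] (-1) n),
          ((ι n x : strictSignedSelmerLayer W κ ℚ_[p] (-1) (n + 1)) : W.subgroupH1 p (κ.layerSubgroup (n + 1))) =
            W.resOfLe p (κ.layerSubgroup_antitone n.le_succ)
              (x : W.subgroupH1 p (κ.layerSubgroup n))) →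
      ∃ (Dn : ∀ n, AddSubgroup (strictSignedSelmerLayer W κ ℚ_[p] (-1) n))
        (pair : ∀ n, strictSignedSelmerLayer W κ ℚ_[p] (-1) n →+ strictSignedSelmerLayer W κ ℚ_[p] (-1) n →+ AddCircle (1 : ℚ)),
      (∀ n (t : strictSignedSelmerLayer W κ ℚ_[p] (-1) (n + 1)), ∃ t' : strictSignedSelmerLayer W κ ℚ_[p] (-1) n,
        r n t' = ∑ i ∈ Finset.range p,
          ((conjStrictSignedSelmerInfty W κ ℚ_[p] (-1) γ) ^ (p ^ n * i)) (r (n + 1) t) ∧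
        ∀ y : strictSignedSelmerLayer W κ ℚ_[p] (-1) n, pair n y t' = pair (n + 1) (ι n y) t) ∧
      (∀ n, ∀ d ∈ Dn n, ∃ d' ∈ Dn n, p • d' = d) ∧
      (∀ n, ∀ d ∈ Dn n, ι n d ∈ Dn (n + 1)) ∧
      (∀ n (t : strictSignedSelmerLayer W κ ℚ_[p] (-1) n),
        (∀ y : strictSignedSelmerLayer W κ ℚ_[p] (-1) n, pair n y t = 0) → t ∈ Dn n) ∧
      (∀ n, ∀ t ∈ Dn n, ∀ y : strictSignedSelmerLayer W κ ℚ_[p] (-1) n, pair n y t = 0) ∧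
      (∀ n (g : strictSignedSelmerLayer W κ ℚ_[p] (-1) n →+ AddCircle (1 : ℚ)), (∀ d ∈ Dn n, g d = 0) →
        ∃ c : strictSignedSelmerLayer W κ ℚ_[p] (-1) n, ∀ y : strictSignedSelmerLayer W κ ℚ_[p] (-1) n, g y = pair n y c) ∧
      (∀ n (y t : strictSignedSelmerLayer W κ ℚ_[p] (-1) n), pair n (γL n y) (γL n t) = pair n y t)) :
    NoFiniteSubmoduleSigned :=
  noFiniteSubmoduleSigned_of_signs (noFiniteSubmodulePlus_of_casselsTatePairings hplus)
    (noFiniteSubmoduleMinus_of_casselsTatePairings hminus)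

end Summit.BirchSwinnertonDyer.BirchSwinnertonDyer.Theorems

end
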